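import Summits.QuantumFields.BalabanUV.T4Continuum.Support.GaugeTermDecomposition
import Summits.QuantumFields.BalabanUV.T4Continuum.Support.ScalarAveragedPropagator

/-!
# T⁴ programme, spine node NE2 (U1a) — THE COLOUR SCALAR LAYER: the covariant scalar averaged operator
# `S_U = D_Rᴴ D_R + a′·Q′(U)ᴴQ′(U)` as a perturbation of `Δ′ = Δ + a′Π′` ON 0-FORMS — objects and the exact decomposition
# (tier B, supplier row B4.e of `t4/formal/NE2/LEAVES.md`, file 1a)

NE2 formalisation swarm `b2b-balaban-t4-ne2-formalise-*`, leaf 01 (row B4.e, file 1).  Row B4.b (the gauge term `D_U R(U) D_U*` of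
[Balaban1985BackgroundPropagators] (3.26) p.395 in the FACTORISED reading (3.25) p.394 «Rf = (I − G′Q′*(Q′G′²Q′*)^{−1}Q′G′)f», `G′ = (Δ′_a)⁻¹`,
`Δ′_a = Δ_U + Q′*aQ′` (3.24)) needs, for its two-level (H-cons) half, the PERTURBED scalar injected law — i.e.
`BackgroundResolventTower.PerturbationLaws` for the scalar-layer perturbation `P_s := S_U − Δ′ ⊗ 1` against the free scalar averaged
operator `Δ′ = ScalarAveragedPropagator.DeltaPs` (row B4.c, p208102) lifted to colour.  THIS FILE (independent of the scalar planting,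
row B4.d) types the objects and proves the exact algebra and the RELATIVE-BOUNDEDNESS half:

 * §1 the colour scalar covariant difference **`scovD c R μ = c·(siteMul (R μ)·(S^s_μ ⊗ 1) − 1)`** on `Tor Nf × o` (the 0-form twin of
   `ColourCovariantLaplacian.covDc`), `connS = c(R − 1)`, `scovD_eq : scovD = ∂_μ ⊗ 1 + siteMul(w_μ)·(S^s_μ ⊗ 1)`, leaf-10's covariant gradient
   through it: **`covGrad_eq_sum_scovD : covGrad = Σ_μ (injM_μ ⊗ 1)·scovD_μ`** and **`covGrad_conjTranspose_mul_covGrad : D_Rᴴ D_R = Σ_μ scovD_μᴴ scovD_μ`**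
   (`=: covLapS`), the free case `lapS_kron : Σ_μ (∂_μ ⊗ 1)ᴴ(∂_μ ⊗ 1) = Δ ⊗ 1`;
 * §2 (real lattice factor `c = n`) THE EXACT DECOMPOSITION **`covLapS_sub_lapS_eq`**: `D_Rᴴ D_R − Δ ⊗ 1 = F + Fᴴ + siteMul z`,
   `F = Σ_μ siteMul(−w_μ)·(∂_μ ⊗ 1)`, `z = Σ_μ [(w_μᴴw_μ)(· − e_μ) − n(w_μ − w_μ(· − e_μ)) − n(…)ᴴ]` — B2's identity VERBATIM on 0-forms;
 * §3 the transported scalar averaging **`QsCov n M T = (Q′ ⊗ 1)·siteMul T`** ([B9] (3.19) p.393 shape — the site factorisation is EXACT on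
   0-forms, owner R4 (2)), the operator **`scalarOp n M a′ R T = D_Rᴴ D_R + a′·n^d·QsCovᴴ QsCov`** (the colour, covariant `Δ′_a` of (3.24) at
   model level) with **`scalarOp_one : scalarOp 1 1 = DeltaPs ⊗ 1`** (BY CONSTRUCTION, c5), the perturbation **`scalarPert = scalarOp − DeltaPs ⊗ 1`**,
   `scalarPert_eq : scalarPert = (F + Fᴴ + siteMul z) + a′·((B·siteMul T)ᴴ(B·siteMul T) − BᴴB)` with `B = √(n^d)·(Q′ ⊗ 1)`, `BᴴB = Π′ ⊗ 1`;
 * the (H-bd) HALF (`‖P_s·(G′ ⊗ 1)‖, ‖(G′ ⊗ 1)·P_s‖ ≤ κ_s(α, β, τ)` from row B4.c's `opNorm_Gps_le`, `opNorm_sdiff_mul_Gps_le`) is the companion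
   `Support/ScalarCovariantLaplacianBounds` (same row, file 1b); the (H-cons) half over the scalar King planting (row B4.d) and the END
   `perturbationLaws_scalarLayer` are file 2 (`ScalarCovariantLaplacianLaws`).

HONEST FRAMING (T4-DAG p. 1).  MODEL LEVEL: colour transporters `R_μ(x)` and site transports `T(x)` are DATA; GLOBAL small field; scalar layer
only; finite torus, linear layer, operator norm; a SUPPLIER of row B4.b's (H-cons), NOT NE2; NOT [Balaban1985BackgroundPropagators] (3.23)–(3.26)
as printed (no regions, no Dirichlet holes); rates / constants OURS; nothing printed is a hypothesis; no `def … : Prop` fact; spine 0/9 unchanged;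
NOT infinite volume / mass gap / Clay / summit progress.  HONEST DEPENDENCY: continuum YM on T⁴ ⇐ BetaPertH ∧ nine spine estimates (0/9 proved);
BetaPertH ⇐ (D1) ∧ (D4) ∧ CAP+tail; G-an2-4 gates asym, D1 and NE2/3/4.  ABSOLUTE RULE kept; no `sorry`.
-/

noncomputable section

open scoped BigOperators ComplexConjugate Matrix Matrix.Norms.L2Operator Kronecker

namespace Summit.QuantumFields.BalabanUV.T4Continuum.ScalarCovariantLaplacian

open Literature.MathematicalPhysics.QuantumFieldTheory.Balaban1983to89.B5Prop11Plancherel (Tor fine unitVec)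
open Literature.MathematicalPhysics.QuantumFieldTheory.Balaban1983to89.B5Action121 (shiftS sdiff LapS GradOp GradOp_conjTranspose_mul_GradOp
  shiftS_conjTranspose_apply)
open Literature.MathematicalPhysics.QuantumFieldTheory.Balaban1983to89.B5Block118 (QsOp)
open Summit.QuantumFields.BalabanUV.T4Continuum
open Summit.QuantumFields.BalabanUV.T4Continuum.KroneckerLift
open Summit.QuantumFields.BalabanUV.T4Continuum.BlockMultiplication
open Summit.QuantumFields.BalabanUV.T4Continuum.KroneckerUnits
open Summit.QuantumFields.BalabanUV.T4Continuum.AbelianCovariantLaplacian (star_natCast_complex)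
open Summit.QuantumFields.BalabanUV.T4Continuum.GaugeTermDecomposition
open Summit.QuantumFields.BalabanUV.T4Continuum.ScalarBlockPoincare (PiS nsq_QsOp_mulVec_le)
open Summit.QuantumFields.BalabanUV.T4Continuum.ScalarAveragedPropagator

variable {d : ℕ} {o : Type*} [Fintype o] [DecidableEq o]

/-! ## §1 The colour scalar covariant difference and leaf-10's covariant gradient -/

section OneLevel

variable (Nf : Fin d → ℕ) [hNf : ∀ μ, NeZero (Nf μ)]

/-- **the colour scalar covariant difference** `(scovD_μ λ)(x) = c·(R_μ(x)·λ(x + e_μ) − λ(x))` on `Tor Nf × o` (the 0-form twin of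
`ColourCovariantLaplacian.covDc`). [cite: Balaban1985BackgroundPropagators, (3.3) p.390 (covariant derivative, shape)] [folklore] -/
def scovD (c : ℂ) (R : Fin d → (Tor Nf → Matrix o o ℂ)) (μ : Fin d) : Matrix (Tor Nf × o) (Tor Nf × o) ℂ :=
  c • (siteMul (R μ) * shiftS Nf μ ⊗ₖ (1 : Matrix o o ℂ) - 1)

/-- the connection in lattice units `w_μ = c·(R_μ − 1)`. [folklore] -/
def connS (c : ℂ) (R : Fin d → (Tor Nf → Matrix o o ℂ)) (μ : Fin d) : Tor Nf → Matrix o o ℂ := fun x => c • (R μ x - 1)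

/-- `scovD_μ = ∂_μ ⊗ 1 + siteMul(w_μ)·(S^s_μ ⊗ 1)`. [folklore] -/
theorem scovD_eq (c : ℂ) (R : Fin d → (Tor Nf → Matrix o o ℂ)) (μ : Fin d) :
    scovD Nf c R μ = sdiff Nf c μ ⊗ₖ (1 : Matrix o o ℂ) + siteMul (connS Nf c R μ) * shiftS Nf μ ⊗ₖ (1 : Matrix o o ℂ) := by
  have e1 : siteMul (connS Nf c R μ) = c • (siteMul (R μ) - 1) := by
    unfold connS; rw [siteMul_smul, siteMul_sub, siteMul_one]
  have e2 : sdiff Nf c μ ⊗ₖ (1 : Matrix o o ℂ) = c • (shiftS Nf μ ⊗ₖ (1 : Matrix o o ℂ) - 1) := by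
    rw [sdiff_def, Matrix.smul_kronecker, sub_kronecker, Matrix.one_kronecker_one]
  rw [scovD, e1, e2, Matrix.smul_mul, Matrix.sub_mul, Matrix.one_mul, ← smul_add]
  congr 1; abel

/-- `injM_μᴴ·injM_ν = 0` for `μ ≠ ν` (different components are orthogonal). [folklore] -/
theorem injMH_mul_injM_of_ne {μ ν : Fin d} (h : μ ≠ ν) : (injM Nf μ)ᴴ * injM Nf ν = 0 := by
  ext y y'
  rw [Matrix.mul_apply, Finset.sum_eq_zero, Matrix.zero_apply]
  intro i _
  rw [injM_conjTranspose_apply, injM]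
  by_cases h1 : i = (y, μ)
  · have h2 : ¬ i = (y', ν) := fun h2 => h (by rw [h1] at h2; exact (Prod.mk.inj h2).2)
    rw [if_neg h2, mul_zero]
  · rw [if_neg h1, zero_mul]

/-- **leaf-10's covariant gradient through the scalar covariant differences**: `D_R = Σ_μ (injM_μ ⊗ 1)·scovD_μ`. [folklore] -/
theorem covGrad_eq_sum_scovD (c : ℂ) (R : Fin d → (Tor Nf → Matrix o o ℂ)) :
    covGrad Nf c R = ∑ μ, injM Nf μ ⊗ₖ (1 : Matrix o o ℂ) * scovD Nf c R μ := by
  rw [covGrad]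
  refine Finset.sum_congr rfl fun μ _ => ?_
  have h1 : siteMul (liftR Nf R μ) * injM Nf μ ⊗ₖ (1 : Matrix o o ℂ) = injM Nf μ ⊗ₖ (1 : Matrix o o ℂ) * siteMul (R μ) := by
    refine (kron_mul_siteMul_eq fun i y hiy => ?_).symm
    have : i = (y, μ) := by by_contra hne; exact hiy (by simp [injM, hne])
    subst this; rfl
  rw [scovD, Matrix.smul_mul, Matrix.mul_smul, Matrix.sub_mul, Matrix.one_mul, Matrix.mul_sub, Matrix.mul_one, Matrix.mul_assoc, ← kron_mul,
    shiftM_mul_injM, kron_mul, ← Matrix.mul_assoc, h1, Matrix.mul_assoc]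

/-- **the colour covariant scalar Laplacian** `Σ_μ scovD_μᴴ scovD_μ`. [folklore] -/
def covLapS (c : ℂ) (R : Fin d → (Tor Nf → Matrix o o ℂ)) : Matrix (Tor Nf × o) (Tor Nf × o) ℂ :=
  ∑ μ, (scovD Nf c R μ)ᴴ * scovD Nf c R μ

/-- **`D_Rᴴ D_R = Σ_μ scovD_μᴴ scovD_μ`** (the components are orthogonal: `injM_μᴴ injM_ν = [μ = ν]`). [folklore] -/
theorem covGrad_conjTranspose_mul_covGrad (c : ℂ) (R : Fin d → (Tor Nf → Matrix o o ℂ)) :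
    (covGrad Nf c R)ᴴ * covGrad Nf c R = covLapS Nf c R := by
  rw [covGrad_eq_sum_scovD, Matrix.conjTranspose_sum, Matrix.sum_mul, covLapS]
  refine Finset.sum_congr rfl fun μ _ => ?_
  rw [Matrix.mul_sum, Finset.sum_eq_single μ]
  · rw [Matrix.conjTranspose_mul, kron_conjTranspose, Matrix.mul_assoc, ← Matrix.mul_assoc ((injM Nf μ)ᴴ ⊗ₖ (1 : Matrix o o ℂ)),
      ← kron_mul, conjTranspose_injM_mul_injM, Matrix.one_kronecker_one, Matrix.one_mul]
  · intro ν _ hν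
    rw [Matrix.conjTranspose_mul, kron_conjTranspose, Matrix.mul_assoc, ← Matrix.mul_assoc ((injM Nf μ)ᴴ ⊗ₖ (1 : Matrix o o ℂ)),
      ← kron_mul, injMH_mul_injM_of_ne Nf (Ne.symm hν), Matrix.zero_kronecker, Matrix.zero_mul, Matrix.mul_zero]
  · intro h; exact absurd (Finset.mem_univ _) h

/-- the free case: `Σ_μ (∂_μ ⊗ 1)ᴴ(∂_μ ⊗ 1) = Δ ⊗ 1` (`Δ = B5Action121.LapS`). [folklore] -/
theorem lapS_kron (c : ℂ) :
    ∑ μ, (sdiff Nf c μ ⊗ₖ (1 : Matrix o o ℂ))ᴴ * sdiff Nf c μ ⊗ₖ (1 : Matrix o o ℂ) = LapS Nf c ⊗ₖ (1 : Matrix o o ℂ) := by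
  rw [LapS, sum_kronecker]
  refine Finset.sum_congr rfl fun μ _ => ?_
  rw [kron_mul, kron_conjTranspose]

/-- `(S^s_μ)ᴴ S^s_μ = 1`. [folklore] -/
theorem conjTranspose_shiftS_mul_shiftS (μ : Fin d) : (shiftS Nf μ)ᴴ * shiftS Nf μ = 1 := by
  ext x y
  rw [Matrix.mul_apply, Finset.sum_eq_single (x - unitVec Nf μ)]
  · simp only [shiftS_conjTranspose_apply, if_true, one_mul, shiftS, sub_add_cancel, Matrix.one_apply]
    by_cases h : x = y
    · rw [if_pos h.symm, if_pos h]
    · rw [if_neg (Ne.symm h), if_neg h]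
  · intro z _ hz; rw [shiftS_conjTranspose_apply, if_neg hz, zero_mul]
  · intro h; exact absurd (Finset.mem_univ _) h

/-- `(S^s_μ ⊗ 1)ᴴ·siteMul (w(· + e_μ))·(S^s_μ ⊗ 1) = siteMul w`. [folklore] -/
theorem conjKronShiftS_siteMul (μ : Fin d) (w : Tor Nf → Matrix o o ℂ) :
    (shiftS Nf μ ⊗ₖ (1 : Matrix o o ℂ))ᴴ * siteMul (fun x => w (x + unitVec Nf μ)) * shiftS Nf μ ⊗ₖ (1 : Matrix o o ℂ) = siteMul w := by
  refine conj_siteMul_of_intertwine (fun x y hxy => ?_) (conjTranspose_shiftS_mul_shiftS Nf μ)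
  have hy : y = x + unitVec Nf μ := by by_contra hne; exact hxy (by simp [shiftS, hne])
  subst hy; rfl

omit [Fintype o] [DecidableEq o] hNf in
/-- `siteMul` of a finite sum (any site index). [folklore] -/
theorem siteMul_finset_sum' {σ : Type*} (s : Finset σ) (f : σ → Tor Nf → Matrix o o ℂ) :
    ∑ x ∈ s, siteMul (f x) = siteMul (fun i => ∑ x ∈ s, f x i) := by
  classical
  induction s using Finset.induction_on with
  | empty =>
    rw [Finset.sum_empty]; ext a b; simp [siteMul_apply]
  | @insert x s hx ih =>
    rw [Finset.sum_insert hx, ih, ← siteMul_add]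
    congr 1; funext i; rw [Finset.sum_insert hx]

/-- the zeroth-order colour field `z = Σ_μ [(w_μᴴw_μ)(· − e_μ) − c(w_μ − w_μ(· − e_μ)) − c(…)ᴴ]`. [folklore] -/
def zfieldS (c : ℂ) (R : Fin d → (Tor Nf → Matrix o o ℂ)) : Tor Nf → Matrix o o ℂ := fun x =>
  ∑ μ, ((connS Nf c R μ (x - unitVec Nf μ))ᴴ * connS Nf c R μ (x - unitVec Nf μ)
    - c • (connS Nf c R μ x - connS Nf c R μ (x - unitVec Nf μ)) - c • (connS Nf c R μ x - connS Nf c R μ (x - unitVec Nf μ))ᴴ)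

/-- the first-order shape `F = Σ_μ siteMul(−w_μ)·(∂_μ ⊗ 1)`. [folklore] -/
def Fshape (c : ℂ) (R : Fin d → (Tor Nf → Matrix o o ℂ)) : Matrix (Tor Nf × o) (Tor Nf × o) ℂ :=
  ∑ μ, siteMul (fun x => -(connS Nf c R μ x)) * sdiff Nf c μ ⊗ₖ (1 : Matrix o o ℂ)

end OneLevel

/-! ## §2 The exact decomposition (real lattice factor `c = n`) -/

section Level

variable (n : ℕ) [NeZero n] (M : Fin d → ℕ) [hM : ∀ μ, NeZero (M μ)]

/-- `(S^s_μ ⊗ 1)ᴴ·(siteMul w·(S^s_μ ⊗ 1)) = siteMul (w(· − e_μ))`. [folklore] -/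
theorem conjKronShiftS_mul_siteMul_shift (μ : Fin d) (w : Tor (fine n M) → Matrix o o ℂ) :
    (shiftS (fine n M) μ ⊗ₖ (1 : Matrix o o ℂ))ᴴ * (siteMul w * shiftS (fine n M) μ ⊗ₖ (1 : Matrix o o ℂ))
      = siteMul (fun x => w (x - unitVec (fine n M) μ)) := by
  have h := conjKronShiftS_siteMul (fine n M) μ (fun x => w (x - unitVec (fine n M) μ)) (o := o)
  have e : (fun x => (fun x => w (x - unitVec (fine n M) μ)) (x + unitVec (fine n M) μ)) = w := funext fun x => by simp
  rw [e] at h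
  rw [← Matrix.mul_assoc]; exact h

/-- `(∂_μ ⊗ 1)ᴴ·siteMul(w)·(S^s_μ ⊗ 1) = −siteMul(w)·(∂_μ ⊗ 1) − n·(siteMul w − siteMul (w(· − e_μ)))`. [folklore] -/
theorem kronSdiffH_mul_siteMul_shift (μ : Fin d) (w : Tor (fine n M) → Matrix o o ℂ) :
    (sdiff (fine n M) ((n : ℕ) : ℂ) μ ⊗ₖ (1 : Matrix o o ℂ))ᴴ * (siteMul w * shiftS (fine n M) μ ⊗ₖ (1 : Matrix o o ℂ))
      = -(siteMul w * sdiff (fine n M) ((n : ℕ) : ℂ) μ ⊗ₖ (1 : Matrix o o ℂ))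
        - ((n : ℕ) : ℂ) • (siteMul w - siteMul (fun x => w (x - unitVec (fine n M) μ))) := by
  have e2 : sdiff (fine n M) ((n : ℕ) : ℂ) μ ⊗ₖ (1 : Matrix o o ℂ) = ((n : ℕ) : ℂ) • (shiftS (fine n M) μ ⊗ₖ (1 : Matrix o o ℂ) - 1) := by
    rw [sdiff_def, Matrix.smul_kronecker, sub_kronecker, Matrix.one_kronecker_one]
  rw [e2, Matrix.conjTranspose_smul, star_natCast_complex, Matrix.conjTranspose_sub, Matrix.conjTranspose_one, Matrix.smul_mul,
    Matrix.sub_mul, Matrix.one_mul, conjKronShiftS_mul_siteMul_shift, Matrix.mul_smul, Matrix.mul_sub, Matrix.mul_one]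
  simp only [smul_sub]
  abel

/-- `(siteMul w (S^s⊗1))ᴴ·(siteMul w (S^s⊗1)) = siteMul ((wᴴw)(· − e_μ))`. [folklore] -/
theorem siteMul_shiftS_sq (μ : Fin d) (w : Tor (fine n M) → Matrix o o ℂ) :
    (siteMul w * shiftS (fine n M) μ ⊗ₖ (1 : Matrix o o ℂ))ᴴ * (siteMul w * shiftS (fine n M) μ ⊗ₖ (1 : Matrix o o ℂ))
      = siteMul (fun x => (w (x - unitVec (fine n M) μ))ᴴ * w (x - unitVec (fine n M) μ)) := by
  rw [Matrix.conjTranspose_mul, siteMul_conjTranspose, Matrix.mul_assoc, ← Matrix.mul_assoc (siteMul fun i => (w i)ᴴ) (siteMul w), siteMul_mul]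
  exact conjKronShiftS_mul_siteMul_shift n M μ (fun x => (w x)ᴴ * w x)

/-- per direction: `scovD_μᴴ scovD_μ − (∂_μ⊗1)ᴴ(∂_μ⊗1) = F_μ + F_μᴴ + zeroth-order`. [folklore] -/
theorem scovD_sq_sub_dir (R : Fin d → (Tor (fine n M) → Matrix o o ℂ)) (μ : Fin d) :
    (scovD (fine n M) ((n : ℕ) : ℂ) R μ)ᴴ * scovD (fine n M) ((n : ℕ) : ℂ) R μ
        - (sdiff (fine n M) ((n : ℕ) : ℂ) μ ⊗ₖ (1 : Matrix o o ℂ))ᴴ * sdiff (fine n M) ((n : ℕ) : ℂ) μ ⊗ₖ (1 : Matrix o o ℂ)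
      = siteMul (fun x => -(connS (fine n M) ((n : ℕ) : ℂ) R μ x)) * sdiff (fine n M) ((n : ℕ) : ℂ) μ ⊗ₖ (1 : Matrix o o ℂ)
        + (siteMul (fun x => -(connS (fine n M) ((n : ℕ) : ℂ) R μ x)) * sdiff (fine n M) ((n : ℕ) : ℂ) μ ⊗ₖ (1 : Matrix o o ℂ))ᴴ
        + (siteMul (fun x => (connS (fine n M) ((n : ℕ) : ℂ) R μ (x - unitVec (fine n M) μ))ᴴ
              * connS (fine n M) ((n : ℕ) : ℂ) R μ (x - unitVec (fine n M) μ))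
            - ((n : ℕ) : ℂ) • (siteMul (connS (fine n M) ((n : ℕ) : ℂ) R μ)
                - siteMul (fun x => connS (fine n M) ((n : ℕ) : ℂ) R μ (x - unitVec (fine n M) μ)))
            - ((n : ℕ) : ℂ) • (siteMul (connS (fine n M) ((n : ℕ) : ℂ) R μ)
                - siteMul (fun x => connS (fine n M) ((n : ℕ) : ℂ) R μ (x - unitVec (fine n M) μ)))ᴴ) := by
  set c : ℂ := ((n : ℕ) : ℂ) with hc
  set w := connS (fine n M) c R μ with hw
  set S := shiftS (fine n M) μ ⊗ₖ (1 : Matrix o o ℂ) with hS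
  set D := siteMul w with hD
  set G := sdiff (fine n M) c μ ⊗ₖ (1 : Matrix o o ℂ) with hG
  have hneg : siteMul (fun x => -(connS (fine n M) c R μ x)) = -D := by rw [hD, ← siteMul_neg]
  have hB : Gᴴ * (D * S) = -(D * G) - c • (D - siteMul (fun x => w (x - unitVec (fine n M) μ))) :=
    kronSdiffH_mul_siteMul_shift n M μ w
  have hBt : (D * S)ᴴ * G = (-(D * G) - c • (D - siteMul (fun x => w (x - unitVec (fine n M) μ))))ᴴ := by
    rw [← hB, Matrix.conjTranspose_mul Gᴴ (D * S), Matrix.conjTranspose_conjTranspose]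
  have hC : (D * S)ᴴ * (D * S) = siteMul (fun x => (w (x - unitVec (fine n M) μ))ᴴ * w (x - unitVec (fine n M) μ)) :=
    siteMul_shiftS_sq n M μ w
  rw [scovD_eq, ← hG, ← hw, ← hD, ← hS, Matrix.conjTranspose_add, Matrix.add_mul, Matrix.mul_add, Matrix.mul_add, hBt, hB, hC, hneg,
    Matrix.conjTranspose_sub, Matrix.conjTranspose_neg, Matrix.conjTranspose_smul, star_natCast_complex, Matrix.neg_mul,
    Matrix.conjTranspose_neg]
  abel

/-- **THE EXACT DECOMPOSITION ON 0-FORMS**: `D_Rᴴ D_R − Δ ⊗ 1 = F + Fᴴ + siteMul z`. [folklore] -/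
theorem covLapS_sub_lapS_eq (R : Fin d → (Tor (fine n M) → Matrix o o ℂ)) :
    covLapS (fine n M) ((n : ℕ) : ℂ) R - LapS (fine n M) ((n : ℕ) : ℂ) ⊗ₖ (1 : Matrix o o ℂ)
      = Fshape (fine n M) ((n : ℕ) : ℂ) R + (Fshape (fine n M) ((n : ℕ) : ℂ) R)ᴴ + siteMul (zfieldS (fine n M) ((n : ℕ) : ℂ) R) := by
  rw [covLapS, ← lapS_kron, ← Finset.sum_sub_distrib, Finset.sum_congr rfl fun μ _ => scovD_sq_sub_dir n M R μ, Finset.sum_add_distrib,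
    Finset.sum_add_distrib, Fshape, ← Matrix.conjTranspose_sum]
  congr 1
  unfold zfieldS
  rw [← siteMul_finset_sum']
  refine Finset.sum_congr rfl fun μ _ => ?_
  simp only [Matrix.conjTranspose_sub, siteMul_conjTranspose, ← siteMul_sub, ← siteMul_smul]

/-! ## §3 The transported scalar averaging and the scalar-layer operator -/

/-- **THE TRANSPORTED SCALAR AVERAGING** `Q′(U) = (Q′ ⊗ 1)·siteMul T` — [B9] (3.19) «(Q′(V)λ)(y) = Σ_{x∈B(y)} L^{−d}R(V(Γ_{y,x}))λ(x)» with the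
site transports `T(x) = R(V(Γ_{y,x}))` as DATA (exact site factorisation on 0-forms). [cite: Balaban1985BackgroundPropagators, (3.19) p.393 (shape)]
[folklore] -/
def QsCov (T : Tor (fine n M) → Matrix o o ℂ) : Matrix (Tor M × o) (Tor (fine n M) × o) ℂ :=
  QsOp n M ⊗ₖ (1 : Matrix o o ℂ) * siteMul T

variable (o)

/-- the normalised free scalar averaging `B = √(n^d)·(Q′ ⊗ 1)`. [folklore] -/
def Bs : Matrix (Tor M × o) (Tor (fine n M) × o) ℂ := (((Real.sqrt ((n : ℝ) ^ d)) : ℝ) : ℂ) • (QsOp n M ⊗ₖ (1 : Matrix o o ℂ))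

omit [NeZero n] in
/-- `BᴴB = Π′ ⊗ 1` (`Π′ = n^d·Q′ᴴQ′ = ScalarBlockPoincare.PiS`). [folklore] -/
theorem Bs_conjTranspose_mul_Bs : (Bs o n M)ᴴ * Bs o n M = PiS n M ⊗ₖ (1 : Matrix o o ℂ) := by
  have hs : star ((((Real.sqrt ((n : ℝ) ^ d)) : ℝ) : ℂ)) = (((Real.sqrt ((n : ℝ) ^ d)) : ℝ) : ℂ) := Complex.conj_ofReal _
  have hss : ((((Real.sqrt ((n : ℝ) ^ d)) : ℝ) : ℂ)) * (((Real.sqrt ((n : ℝ) ^ d)) : ℝ) : ℂ) = ((n : ℂ)) ^ d := by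
    rw [← Complex.ofReal_mul, Real.mul_self_sqrt (pow_nonneg (Nat.cast_nonneg _) d)]; push_cast; rfl
  rw [Bs, Matrix.conjTranspose_smul, hs, Matrix.smul_mul, Matrix.mul_smul, smul_smul, hss, kron_conjTranspose, ← kron_mul, PiS,
    Matrix.smul_kronecker]

/-- `‖B‖ ≤ 1`. [folklore] -/
theorem opNorm_Bs_le : ‖Bs o n M‖ ≤ 1 := by
  have hpos : 0 < Real.sqrt ((n : ℝ) ^ d) := Real.sqrt_pos.mpr (pow_pos (by exact_mod_cast Nat.pos_of_ne_zero (NeZero.ne n)) d)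
  have hQ : ‖QsOp n M‖ ≤ (Real.sqrt ((n : ℝ) ^ d))⁻¹ := by
    refine opNorm_le_of_nsq_le_rect _ (inv_nonneg.mpr hpos.le) fun v => ?_
    rw [inv_pow, Real.sq_sqrt (pow_nonneg (Nat.cast_nonneg _) d)]
    exact nsq_QsOp_mulVec_le n M v
  rw [Bs, norm_smul, Complex.norm_real, Real.norm_of_nonneg hpos.le]
  calc Real.sqrt ((n : ℝ) ^ d) * ‖QsOp n M ⊗ₖ (1 : Matrix o o ℂ)‖ ≤ Real.sqrt ((n : ℝ) ^ d) * (Real.sqrt ((n : ℝ) ^ d))⁻¹ :=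
        mul_le_mul_of_nonneg_left ((opNorm_kron_le o _).trans hQ) hpos.le
    _ = 1 := mul_inv_cancel₀ hpos.ne'

variable {o}

/-- **THE COLOUR COVARIANT SCALAR AVERAGED OPERATOR** `S_U = D_Rᴴ D_R + a′·(B·siteMul T)ᴴ(B·siteMul T)` (= `D_Rᴴ D_R + a′·n^d·Q′(U)ᴴQ′(U)`), the
model of [B9] (3.24) `Δ′_a = Δ_U + Q′*aQ′` on the colour scalar layer. [cite: Balaban1985BackgroundPropagators, (3.24) p.394 (shape)] [folklore] -/
def scalarOp (a' : ℝ) (R : Fin d → (Tor (fine n M) → Matrix o o ℂ)) (T : Tor (fine n M) → Matrix o o ℂ) :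
    Matrix (Tor (fine n M) × o) (Tor (fine n M) × o) ℂ :=
  covLapS (fine n M) ((n : ℕ) : ℂ) R + (a' : ℂ) • ((Bs o n M * siteMul T)ᴴ * (Bs o n M * siteMul T))

/-- **`S_1 = Δ′ ⊗ 1` BY CONSTRUCTION** (`R = 1`, `T = 1`): the typed operator reduces to `ScalarAveragedPropagator.DeltaPs ⊗ 1` (trigger c5). [folklore] -/
theorem scalarOp_one (a' : ℝ) :
    scalarOp n M a' (fun _ _ => (1 : Matrix o o ℂ)) (fun _ => (1 : Matrix o o ℂ)) = DeltaPs n M a' ⊗ₖ (1 : Matrix o o ℂ) := by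
  have h1 : covLapS (fine n M) ((n : ℕ) : ℂ) (fun _ _ => (1 : Matrix o o ℂ)) = LapS (fine n M) ((n : ℕ) : ℂ) ⊗ₖ (1 : Matrix o o ℂ) := by
    rw [covLapS, ← lapS_kron]
    refine Finset.sum_congr rfl fun μ _ => ?_
    rw [scovD, siteMul_one, Matrix.one_mul, sdiff_def, Matrix.smul_kronecker, sub_kronecker, Matrix.one_kronecker_one]
  rw [scalarOp, h1, siteMul_one, Matrix.mul_one, Bs_conjTranspose_mul_Bs, DeltaPs, Matrix.add_kronecker, Matrix.smul_kronecker]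

/-- **THE SCALAR-LAYER PERTURBATION** `P_s = S_U − Δ′ ⊗ 1`. [folklore] -/
def scalarPert (a' : ℝ) (R : Fin d → (Tor (fine n M) → Matrix o o ℂ)) (T : Tor (fine n M) → Matrix o o ℂ) :
    Matrix (Tor (fine n M) × o) (Tor (fine n M) × o) ℂ :=
  scalarOp n M a' R T - DeltaPs n M a' ⊗ₖ (1 : Matrix o o ℂ)

/-- `P_s = (F + Fᴴ + siteMul z) + a′·((B·siteMul T)ᴴ(B·siteMul T) − BᴴB)`. [folklore] -/
theorem scalarPert_eq (a' : ℝ) (R : Fin d → (Tor (fine n M) → Matrix o o ℂ)) (T : Tor (fine n M) → Matrix o o ℂ) :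
    scalarPert n M a' R T
      = (Fshape (fine n M) ((n : ℕ) : ℂ) R + (Fshape (fine n M) ((n : ℕ) : ℂ) R)ᴴ + siteMul (zfieldS (fine n M) ((n : ℕ) : ℂ) R))
        + (a' : ℂ) • ((Bs o n M * siteMul T)ᴴ * (Bs o n M * siteMul T) - (Bs o n M)ᴴ * Bs o n M) := by
  rw [scalarPert, scalarOp, ← covLapS_sub_lapS_eq, Bs_conjTranspose_mul_Bs, DeltaPs, Matrix.add_kronecker, Matrix.smul_kronecker, smul_sub]
  abel

/-- `P_s = 0` at `R = 1`, `T = 1`. [folklore] -/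
theorem scalarPert_one (a' : ℝ) : scalarPert n M a' (fun _ _ => (1 : Matrix o o ℂ)) (fun _ => (1 : Matrix o o ℂ)) = 0 := by
  rw [scalarPert, scalarOp_one, sub_self]

/-- `P_s` is Hermitian. [folklore] -/
theorem scalarPert_conjTranspose (a' : ℝ) (R : Fin d → (Tor (fine n M) → Matrix o o ℂ)) (T : Tor (fine n M) → Matrix o o ℂ) :
    (scalarPert n M a' R T)ᴴ = scalarPert n M a' R T := by
  have hL : (covLapS (fine n M) ((n : ℕ) : ℂ) R)ᴴ = covLapS (fine n M) ((n : ℕ) : ℂ) R := by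
    rw [covLapS, Matrix.conjTranspose_sum]
    exact Finset.sum_congr rfl fun μ _ => by rw [Matrix.conjTranspose_mul, Matrix.conjTranspose_conjTranspose]
  have hD : (DeltaPs n M a' ⊗ₖ (1 : Matrix o o ℂ))ᴴ = DeltaPs n M a' ⊗ₖ (1 : Matrix o o ℂ) := by
    rw [kron_conjTranspose, (DeltaPs_isHermitian n M a').eq]
  rw [scalarPert, scalarOp, Matrix.conjTranspose_sub, Matrix.conjTranspose_add, hL, hD, Matrix.conjTranspose_smul, Complex.star_def,
    Complex.conj_ofReal, Matrix.conjTranspose_mul, Matrix.conjTranspose_conjTranspose]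

end Level

end Summit.QuantumFields.BalabanUV.T4Continuum.ScalarCovariantLaplacian

end
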